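import Mathlib.Data.Finset.Card
import Literature.Computability.MetaComplexity.ResLin
import Literature.Computability.MetaComplexity.ResLinProofs
import Literature.Computability.MetaComplexity.RevResLin
import Literature.Computability.MetaComplexity.ResLinWidth
import Literature.Computability.MetaComplexity.ResLinResolventImplication
import HarnessLib

/-!
# Rank-winning strategies for Res(⊕): the existential pebble game for the RANK measure

The Spoiler–Duplicator (existential pebble) game characterising the RANK of Res(⊕) refutations —
rank of a refutation = the maximal rank `rk(¬C)` of (the negation of) a line, the tree's
`resLinWidth` / `linClauseRank` (`ResLinWidth.lean`) — as used by Alekseev–Itsykson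
[STOC 2025 = ECCC TR24-128, §3, "Spoiler-Duplicator game for Res(⊕)", after Garlík–Kołodziejczyk
2018]. A Duplicator strategy is a nonempty family `H` of linear systems over `𝔽₂` with

1. `rk F ≤ K` for every `F ∈ H`;
2. every clause of `φ` is satisfied by some solution of every `F ∈ H`;
3. `H` is closed under semantic consequences of rank `≤ K`;
4. every `F ∈ H` with `rk F < K` extends inside `H` by `f = a` for every linear form `f` and a
   suitable constant `a`.

This is the companion of `IsWinningStrategy` (`ResLinWinningStrategy.lean`,
Gryaznov–Ovcharov–Riazanov 2024), which measures a system by its NUMBER OF EQUATIONS; here the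
measure is the rank `linClauseRank F = dim ⟨L(F)⟩` (for a system `F : Finset LinLit` read as a set of
equations; the rank ignores the constants, so it is also the rank of the clause `¬F`).

* `IsRankWinningStrategy φ K H` — the definition [Alekseev–Itsykson 2025, §3, the four bullet
  points before Lemma 3.3], `IsRankWinningStrategy.empty_mem`;
* `IsRankWinningStrategy.lt_resLinWidth` — [Alekseev–Itsykson 2025, Lemma 3.3]: a
  `(k+1)`-rank-winning strategy forbids Res(⊕) refutations of rank `≤ k`: every refutation
  (resolution rule + SEMANTIC weakening, `IsResLinRefutation`) has a line of rank `> k`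
  (forward induction along the refutation with the invariant "every line is satisfied by some
  solution of every `F ∈ H`", as in GOR Lemma 6 / `ResLinWidthFromStrategy.lean`).

## Design notes

* A linear SYSTEM is a `Finset LinLit` (`(f, b)` reads `⊕_{i∈f} xᵢ = b`); `σ` solves `F` iff
  `∀ e ∈ F, LinLit.eval σ e = true`; the clause `¬F` is `F.image fun e => (e.1, !e.2)` and has the
  same forms, hence the same rank (`linClauseRank_image_not`).
* Property (3) asks the rank bound of the consequence as a hypothesis (as GOR do for the
  cardinality); for a CONSISTENT `F` a consequence automatically has its forms in `⟨L(F)⟩`, but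
  this is not needed here.
* What is NOT here: the converse (from rank-hardness to a strategy), the game presentation, any
  lifting (see `ResLinWidthLifting.lean`).

## References

* Y. Alekseev, D. Itsykson, *Lifting to bounded-depth and regular resolutions over parities via
  games*, STOC 2025, 584–595 (= ECCC TR24-128, 2024), §3 (Res(⊕) existential `k`-pebble game,
  Lemma 3.3) [AlekseevItsykson2025].
* S. Gryaznov, S. Ovcharov, A. Riazanov, ACM ToCT 16(3) (2024), §4, Lemma 6
  [GryaznovOvcharovRiazanov2024].
* A. Atserias, V. Dalmau, JCSS 74 (2008), Def. 2 [AtseriasDalmau2008].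
-/

namespace Literature.Computability.MetaComplexity

open _root_.Computability Complexity

/-! ### Rank-winning strategies -/

/-- A **`K`-rank-winning strategy** for the CNF `φ` [Alekseev–Itsykson 2025, §3 ("Duplicator wins
the Res(⊕) existential `k`-pebble game"), after Garlík–Kołodziejczyk 2018]: a nonempty family `H`
of linear systems over `𝔽₂` such that (1) every `F ∈ H` has rank `rk F = dim ⟨L(F)⟩ ≤ K`;
(2) for every `F ∈ H` and every clause `C` of `φ` some solution of `F` satisfies `C`; (3) `H` is
closed under semantic consequences of rank `≤ K`; (4) every `F ∈ H` with `rk F < K` extends inside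
`H` by `f = a` for every linear form `f` and some constant `a`. The rank analogue of
`IsWinningStrategy` (number of equations, Gryaznov–Ovcharov–Riazanov 2024).
[cite: AlekseevItsykson2025, §3 (Res(⊕) existential pebble game)] -/
structure IsRankWinningStrategy (φ : CNF ℕ) (K : ℕ) (H : Set (Finset LinLit)) : Prop where
  /-- `H` is nonempty. -/
  nonempty : ∃ F, F ∈ H
  /-- (1) rank at most `K`. -/
  rank_le : ∀ F ∈ H, linClauseRank F ≤ K
  /-- (2) every clause of `φ` is satisfied by some solution of every `F ∈ H`. -/
  exists_sat : ∀ F ∈ H, ∀ c ∈ φ, ∃ σ : ℕ → Bool,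
    (∀ e ∈ F, LinLit.eval σ e = true) ∧ (Clause.toLinClause c).eval σ = true
  /-- (3) closure under semantic consequences of rank `≤ K`. -/
  mem_of_imp : ∀ F ∈ H, ∀ G : Finset LinLit,
    (∀ σ : ℕ → Bool, (∀ e ∈ F, LinLit.eval σ e = true) → ∀ e ∈ G, LinLit.eval σ e = true) →
    linClauseRank G ≤ K → G ∈ H
  /-- (4) extension by any linear form below rank `K`. -/
  exists_insert_mem : ∀ F ∈ H, linClauseRank F < K → ∀ f : Finset ℕ,
    ∃ a : Bool, insert (f, a) F ∈ H

/-- The empty system belongs to every rank-winning strategy (it is a rank-`0` consequence of any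
member). [cite: AlekseevItsykson2025, §3 (Res(⊕) existential pebble game)] -/
theorem IsRankWinningStrategy.empty_mem {φ : CNF ℕ} {K : ℕ} {H : Set (Finset LinLit)}
    (hH : IsRankWinningStrategy φ K H) : (∅ : Finset LinLit) ∈ H := by
  obtain ⟨F, hF⟩ := hH.nonempty
  exact hH.mem_of_imp F hF ∅ (by simp) (by simp)

/-! ### Semantic helpers -/

/-- A linear clause is false at `σ` iff all its literals are (local helper).
[Itsykson–Sokolov 2020, §2] [cite: ItsyksonSokolov2020, §2] -/
private theorem linClause_eval_eq_false_iff_rws (σ : ℕ → Bool) (C : LinClause) :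
    C.eval σ = false ↔ ∀ l ∈ C, LinLit.eval σ l = false := by
  unfold LinClause.eval
  simp only [decide_eq_false_iff_not, not_exists, not_and, Bool.not_eq_true]

/-- The negated system `¬C = {(f, ¬b) : (f, b) ∈ C}` has the same linear forms as `C`.
[Efremenko–Garlík–Itsykson 2024, §2.2 (`L(C)` = `L(¬C)`)] [cite: EfremenkoGarlikItsykson2024, §2.2] -/
theorem LinClause.forms_image_not (C : LinClause) :
    LinClause.forms (C.image fun l => (l.1, !l.2)) = LinClause.forms C := by
  ext v
  simp only [LinClause.mem_forms_iff, Finset.mem_image]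
  constructor
  · rintro ⟨_, ⟨l, hl, rfl⟩, hv⟩
    exact ⟨l, hl, hv⟩
  · rintro ⟨l, hl, hv⟩
    exact ⟨(l.1, !l.2), ⟨l, hl, rfl⟩, hv⟩

/-- Hence the negated system has the same rank: `rk(¬C) = linClauseRank C`.
[Efremenko–Garlík–Itsykson 2024, §2.2] [cite: EfremenkoGarlikItsykson2024, §2.2] -/
theorem linClauseRank_image_not (C : LinClause) :
    linClauseRank (C.image fun l => (l.1, !l.2)) = linClauseRank C := by
  rw [linClauseRank_eq, linClauseRank_eq, LinClause.forms_image_not]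

/-- If `σ` solves the negated system `¬C`, then `C` is false at `σ`. [Itsykson–Sokolov 2020, §2]
[cite: ItsyksonSokolov2020, §2] -/
theorem linClause_eval_eq_false_of_forall_image_not {σ : ℕ → Bool} {C : LinClause}
    (h : ∀ e ∈ C.image (fun l => (l.1, !l.2)), LinLit.eval σ e = true) : C.eval σ = false := by
  rw [linClause_eval_eq_false_iff_rws]
  intro l hl
  have h1 := h (l.1, !l.2) (Finset.mem_image.2 ⟨l, hl, rfl⟩)
  rw [linLit_eval_not] at h1
  rcases l with ⟨f, b⟩
  revert h1
  cases LinLit.eval σ (f, b) <;> simp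

/-- Conversely, if `C` is false at `σ`, then `σ` solves `¬C`. [Itsykson–Sokolov 2020, §2]
[cite: ItsyksonSokolov2020, §2] -/
theorem forall_image_not_of_linClause_eval_eq_false {σ : ℕ → Bool} {C : LinClause}
    (h : C.eval σ = false) : ∀ e ∈ C.image (fun l => (l.1, !l.2)), LinLit.eval σ e = true := by
  intro e he
  obtain ⟨l, hl, rfl⟩ := Finset.mem_image.1 he
  have h1 := (linClause_eval_eq_false_iff_rws σ C).1 h l hl
  rw [linLit_eval_not]
  rcases l with ⟨f, b⟩
  revert h1
  cases LinLit.eval σ (f, b) <;> simp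

/-! ### Lemma 3.3: a rank-winning strategy forbids low-rank refutations -/

/-- **The invariant** [Alekseev–Itsykson 2025, proof of Lemma 3.3; Gryaznov–Ovcharov–Riazanov 2024,
Lemma 6]. If `H` is a `(k+1)`-rank-winning strategy for `φ` and `π` is a Res(⊕) derivation from `φ`
all of whose lines have rank `≤ k`, then every line of `π` is satisfied by some solution of every
`F ∈ H` (strong induction on the position of the line: initial clauses by (2), a weakening by
semantics, a resolvent `C ∨ D` of `C ∨ (f = 0)` and `D ∨ (f = 1)` because otherwise `¬(C ∨ D)` is a
rank-`≤ k` consequence of `F`, hence in `H` by (3), extends by `f = a` by (4), and the extension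
refutes the invariant at one of the premises). [cite: AlekseevItsykson2025, Lemma 3.3] -/
theorem IsRankWinningStrategy.exists_sat_of_mem {φ : CNF ℕ} {k : ℕ} {H : Set (Finset LinLit)}
    (hH : IsRankWinningStrategy φ (k + 1) H) {π : List ResLinLine} (hπ : IsResLinDerivation φ π)
    (hw : ∀ l ∈ π, linClauseRank l.clause ≤ k) :
    ∀ l ∈ π, ∀ F ∈ H, ∃ σ : ℕ → Bool,
      (∀ e ∈ F, LinLit.eval σ e = true) ∧ l.clause.eval σ = true := by
  classical
  -- strong induction on the position of the line
  suffices key : ∀ n, ∀ i (hi : i < π.length), i < n → ∀ F ∈ H, ∃ σ : ℕ → Bool,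
      (∀ e ∈ F, LinLit.eval σ e = true) ∧ (π[i]'hi).clause.eval σ = true by
    intro l hl
    obtain ⟨i, hi, rfl⟩ := List.getElem_of_mem hl
    exact key (i + 1) i hi (Nat.lt_succ_self i)
  intro n
  induction n with
  | zero => intro i hi hn; exact absurd hn (Nat.not_lt_zero _)
  | succ n ih =>
      intro i hi hin F hF
      have hvalid := hπ i hi
      have hk : linClauseRank (π[i]'hi).clause ≤ k := hw _ (List.getElem_mem hi)
      unfold IsValidResLinLine at hvalid
      rcases hrule : (π[i]'hi).rule with _ | ⟨a, b, f⟩ | ⟨a⟩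
      · -- an initial clause: property (2)
        rw [hrule] at hvalid
        obtain ⟨c, hc, hcl⟩ := hvalid
        rw [hcl]
        exact hH.exists_sat F hF c hc
      · -- a resolvent `C ∪ D` of `C ∨ (f = 0)` (line `a`) and `D ∨ (f = 1)` (line `b`)
        rw [hrule] at hvalid
        obtain ⟨ha, hb, C, D, hCa, hDb, hcl⟩ := hvalid
        rw [List.length_take] at ha hb
        have ha' : a < π.length := lt_of_lt_of_le ha (min_le_right _ _)
        have hb' : b < π.length := lt_of_lt_of_le hb (min_le_right _ _)
        have hai : a < i := lt_of_lt_of_le ha (min_le_left _ _)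
        have hbi : b < i := lt_of_lt_of_le hb (min_le_left _ _)
        rw [List.getElem_take] at hCa hDb
        rw [hcl] at hk ⊢
        by_contra hnone
        push Not at hnone
        -- every solution of `F` falsifies `C ∪ D`: the negated system `G = ¬(C ∪ D)` is a
        -- consequence of `F` of rank `≤ k`
        set G : Finset LinLit := (C ∪ D).image fun l => (l.1, !l.2) with hG
        have hFG : ∀ σ : ℕ → Bool, (∀ e ∈ F, LinLit.eval σ e = true) →
            ∀ e ∈ G, LinLit.eval σ e = true := by
          intro σ hσ
          have hfalse : (C ∪ D).eval σ = false := by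
            have := hnone σ hσ
            revert this
            cases (C ∪ D).eval σ <;> simp
          exact forall_image_not_of_linClause_eval_eq_false hfalse
        have hGrank : linClauseRank G ≤ k := by rw [hG, linClauseRank_image_not]; exact hk
        have hGmem : G ∈ H := hH.mem_of_imp F hF G hFG (hGrank.trans (Nat.le_succ k))
        obtain ⟨c, hc⟩ := hH.exists_insert_mem G hGmem (Nat.lt_succ_of_le hGrank) f
        -- solutions of `G ∧ (f = c)` falsify `C ∪ D` and have `f = c`
        have hsolG : ∀ σ : ℕ → Bool, (∀ e ∈ insert (f, c) G, LinLit.eval σ e = true) →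
            LinLit.eval σ (f, c) = true ∧ C.eval σ = false ∧ D.eval σ = false := by
          intro σ hσ
          have hCD : (C ∪ D).eval σ = false :=
            linClause_eval_eq_false_of_forall_image_not fun e he =>
              hσ e (Finset.mem_insert_of_mem he)
          rw [linClause_eval_eq_false_iff_rws] at hCD
          refine ⟨hσ _ (Finset.mem_insert_self _ _), ?_, ?_⟩
          · exact (linClause_eval_eq_false_iff_rws σ C).2 fun l hl =>
              hCD l (Finset.mem_union_left D hl)
          · exact (linClause_eval_eq_false_iff_rws σ D).2 fun l hl =>
              hCD l (Finset.mem_union_right C hl)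
        cases c with
        | true =>
          -- the premise `C ∨ (f = 0)` (line `a`) is false at every solution of `G ∧ (f = 1)`
          obtain ⟨σ, hσ, hline⟩ := ih a ha' (by omega) _ hc
          obtain ⟨hf, hC, -⟩ := hsolG σ hσ
          rw [hCa] at hline
          have : LinClause.eval σ (insert (f, false) C) = false := by
            rw [linClause_eval_eq_false_iff_rws]
            intro l hl
            rcases Finset.mem_insert.1 hl with rfl | hl
            · have h1 := LinLit.eval_true_eq_not σ f
              rw [hf] at h1
              revert h1
              cases LinLit.eval σ (f, false) <;> simp
            · exact (linClause_eval_eq_false_iff_rws σ C).1 hC l hl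
          rw [this] at hline
          exact Bool.false_ne_true hline
        | false =>
          -- the premise `D ∨ (f = 1)` (line `b`) is false at every solution of `G ∧ (f = 0)`
          obtain ⟨σ, hσ, hline⟩ := ih b hb' (by omega) _ hc
          obtain ⟨hf, -, hD⟩ := hsolG σ hσ
          rw [hDb] at hline
          have : LinClause.eval σ (insert (f, true) D) = false := by
            rw [linClause_eval_eq_false_iff_rws]
            intro l hl
            rcases Finset.mem_insert.1 hl with rfl | hl
            · have h1 := LinLit.eval_true_eq_not σ f
              rw [hf] at h1
              revert h1
              cases LinLit.eval σ (f, true) <;> simp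
            · exact (linClause_eval_eq_false_iff_rws σ D).1 hD l hl
          rw [this] at hline
          exact Bool.false_ne_true hline
      · -- a semantic weakening of line `a`
        rw [hrule] at hvalid
        obtain ⟨ha, himp⟩ := hvalid
        rw [List.length_take] at ha
        have ha' : a < π.length := lt_of_lt_of_le ha (min_le_right _ _)
        have hai : a < i := lt_of_lt_of_le ha (min_le_left _ _)
        rw [List.getElem_take] at himp
        obtain ⟨σ, hσ, hline⟩ := ih a ha' (by omega) F hF
        exact ⟨σ, hσ, himp σ hline⟩

/-- **Lemma 3.3** [Alekseev–Itsykson 2025] (cf. Garlík–Kołodziejczyk 2018; Gryaznov–Ovcharov–Riazanov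
2024, Lemma 6, for the number of equations): if `φ` has a `(k+1)`-rank-winning strategy, then
`φ` has no Res(⊕) refutation of rank `≤ k` — every Res(⊕) refutation of `φ` (resolution rule +
semantic weakening) has a line `C` with `rk(¬C) = linClauseRank C > k`, i.e. `k < resLinWidth π`.
[cite: AlekseevItsykson2025, Lemma 3.3] -/
theorem IsRankWinningStrategy.lt_resLinWidth {φ : CNF ℕ} {k : ℕ} {H : Set (Finset LinLit)}
    (hH : IsRankWinningStrategy φ (k + 1) H) {π : List ResLinLine} (hπ : IsResLinRefutation φ π) :
    k < resLinWidth π := by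
  by_contra hcon
  rw [lt_resLinWidth_iff] at hcon
  push Not at hcon
  obtain ⟨hder, l, hl, hlcl⟩ := hπ
  obtain ⟨σ, -, hσ⟩ := hH.exists_sat_of_mem hder hcon l hl ∅ hH.empty_mem
  rw [hlcl] at hσ
  simp at hσ

/-- Pointwise form of Lemma 3.3: some line has rank `> k`. [cite: AlekseevItsykson2025, Lemma 3.3] -/
theorem IsRankWinningStrategy.exists_lt_linClauseRank {φ : CNF ℕ} {k : ℕ} {H : Set (Finset LinLit)}
    (hH : IsRankWinningStrategy φ (k + 1) H) {π : List ResLinLine} (hπ : IsResLinRefutation φ π) :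
    ∃ l ∈ π, k < linClauseRank l.clause :=
  lt_resLinWidth_iff.1 (hH.lt_resLinWidth hπ)

end Literature.Computability.MetaComplexity
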